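import Mathlib
import HarnessLib
import Summits.Ventures.LatticeQCDFlow.Scoring.HMCKernelSymmetry
import Summits.Ventures.LatticeQCDFlow.Exactness.GlobalAutomorphismSymmetry

/-!
# The HMC kernel commutes with charge conjugation (momenta conjugated with the links): `⟨Im tr P⟩ = 0` at EVERY step of an `SU(N)` HMC run from a cold or hot start

HONEST FRAMING: exact (Metropolis-corrected) sampling algorithms for lattice gauge theory;
figures of merit are autocorrelation/cost numbers at stated couplings and volumes; no
continuum-physics claim.

Venture `LatticeQCDFlow` (cell pub-lqcd), sub-topic `Scoring`, FANOUT row 21 (`su3-base`, arm HMC: the `SU(3)` baseline run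
measures Polyakov lines and plaquettes along the Markov chain).  NEW WORK of the cell — the charge-conjugation twin of row 16's
`HMCKernelSymmetry` (§3, `Θ'`) and row 21's `HMCKernelAxisPermutation` (`configPerm π`), for the SAME kernel `hmcKernel B β ε w`
(Gaussian momentum refresh in the basis `B`, ANY kick–drift word `w` at step `ε` — leapfrog, OMF2, OMF4 —, Metropolis test on
`ΔH`), over `Exactness/GlobalAutomorphismSymmetry` (charge conjugation `configConj N = configAut (suConjAut N)` of the links,
the Literature's entrywise conjugation `suConj`; `Re tr` is `C`-even, `Im tr` is `C`-odd; Haar is `C`-invariant) and the cell's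
register calculus (`WilsonFlowRK3`: `flowGen`, `rkRegister`, `rkPush`, `expSU`; `KickDriftSymmetry`: `mdWord`, `kinetic`,
`mdHamiltonian`; `MomentumLawSymmetry`: `momOf`, `coordMap`, `measurePreserving_coordMap`).  Nothing is cited as a fact;
no number.  Printed counterpart, NAMED ONLY: `C`-symmetry of the Wilson action and of the HMC update (Duane–Kennedy–
Pendleton–Roweth 1987; Montvay–Münster §3.2).

## What is proved (every `d`, `L ≥ 1`, `N`, `β`, `ε`, word `w`, basis `B : SuBasis N`)

* §1 `suAlgConj` — entrywise conjugation `X ↦ X̄` is an `ℝ`-linear map of `𝔰𝔲(N)`; `conjReg P = (X̄_e)_e` the induced map of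
  momentum fields; `suProj_mapConj` (Lüscher's projection commutes with conjugation), `plaquetteLoopSum_configConj`, hence
  **`flowGen_configConj`** (`Z(Ū) = conj Z(U)`), `rkRegister_configConj`, `exp_mapConj` / `expSU_suAlgConj` (`e^{X̄} = conj e^X`),
  `rkPush_configConj`; **`mdWord_conjPhase`** — EVERY kick–drift word is conjugation-equivariant on phase space;
  `kinetic_conjReg` (`K(P̄) = K(P)`), `energyChange_conjPhase` (`ΔH` is invariant), `wilsonMDAction_configConj`;
  `wilsonFlowRK3_configConj` (the RK3 integrator of the MEASURED flow commutes with `C` too).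
* §2 **`hmcStep_configConj`**: `hmcStep (Ū) (O c, u) = conj (hmcStep U (c, u))` with `O = coordMap (conjRegₗ)` the coordinate
  form of the momentum conjugation, which preserves the Gaussian draw (`measurePreserving_noise_conjReg`, from `K(P̄) = K(P)`);
  hence **`hmcKernel_configConj`**: `κ(Ū) = C_* κ(U)` and **`conjKernel_hmcKernel_configConj`**: `conjKernel κ C = κ`.
* §3 `C`-invariant starts stay `C`-invariant: `configConj_one` (cold start), `piHaar_map_configConj` (hot start),
  **`hmcChain_law_map_configConj`**, `integral_hmcChain_comp_configConj`; and the run check: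
  **`integral_hmcChain_im_trace_eq_zero_of_equivariant`** — for every conjugation-equivariant `SU(N)`-valued loop functional
  `h` (links, plaquettes, straight / Polyakov lines), `E_N[Im tr h(U_N)] = 0` AT EVERY STEP `N` of the chain from any
  `C`-invariant start; instances **`integral_hmcChain_im_trace_lineHolonomy_eq_zero`** (Polyakov lines),
  `integral_hmcChain_im_trace_plaquette_eq_zero`, and the engine's two starts `integral_hmcColdStart_im_trace_lineHolonomy_eq_zero`,
  `integral_hmcHotStart_im_trace_lineHolonomy_eq_zero`.  So in an `SU(3)` HMC run a measured `⟨Im tr P⟩ ≠ 0` beyond errors —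
  at ANY Markov time, thermalised or not — indicts the implementation or the estimator, never the algorithm.

NOT CLAIMED: arm E1 / heat bath; stationarity of `κ`; anything about `Re tr P` (centre symmetry); the open-boundary HMC kernel
(its MD force is the weighted one — same template, not typed here); floating point; numbers.
-/

noncomputable section

open Matrix MeasureTheory ProbabilityTheory ProbabilityTheory.Kernel
open Literature.MathematicalPhysics.QuantumFieldTheory
open Literature.MathematicalPhysics.QuantumFieldTheory.Luscher2010 (SuBasis)
open Literature.MathematicalPhysics.QuantumLattice (fundamentalRep continuous_fundamentalRep)
open Summit.Ventures.LatticeQCDFlow.Exactness (conjKernel conjKernel_apply nHit configAut configAut_apply suConjAut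
  suConjAut_apply configConj)

namespace Summit.Ventures.LatticeQCDFlow.Scoring

variable {d L n : ℕ}

/-- Entrywise complex conjugation of `n × n` complex matrices, as a ring endomorphism (local notation). -/
local notation "𝐂" => (RingHom.mapMatrix (starRingEnd ℂ) : Matrix (Fin n) (Fin n) ℂ →+* Matrix (Fin n) (Fin n) ℂ)

/-! ## §1 Conjugation of matrices, of `𝔰𝔲(n)`, of registers; equivariance of generator, kicks, drifts, words -/

section Registers

/-- Entrywise conjugation is the transpose of the conjugate transpose. -/
theorem mapConj_eq_transpose_conjTranspose (A : Matrix (Fin n) (Fin n) ℂ) : 𝐂 A = (Aᴴ)ᵀ := by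
  ext i j; rfl

/-- Entrywise conjugation commutes with the conjugate transpose. -/
theorem conjTranspose_mapConj (A : Matrix (Fin n) (Fin n) ℂ) : (𝐂 A)ᴴ = 𝐂 (Aᴴ) := by
  ext i j; simp [Matrix.conjTranspose_apply, RingHom.mapMatrix_apply, Matrix.map_apply]

/-- The trace of the conjugate is the conjugate of the trace. -/
theorem trace_mapConj (A : Matrix (Fin n) (Fin n) ℂ) : (𝐂 A).trace = starRingEnd ℂ A.trace := by
  simp only [RingHom.mapMatrix_apply, Matrix.trace, Matrix.diag, Matrix.map_apply, map_sum]

/-- Conjugation of a complex multiple. -/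
theorem mapConj_smul (c : ℂ) (A : Matrix (Fin n) (Fin n) ℂ) : 𝐂 (c • A) = starRingEnd ℂ c • 𝐂 A := by
  ext i j; simp [RingHom.mapMatrix_apply, Matrix.map_apply, Matrix.smul_apply]

/-- Conjugation of a real multiple. -/
theorem mapConj_real_smul (r : ℝ) (A : Matrix (Fin n) (Fin n) ℂ) : 𝐂 (r • A) = r • 𝐂 A := by
  ext i j; simp [RingHom.mapMatrix_apply, Matrix.map_apply, Matrix.smul_apply]

/-- **Lüscher's projection onto `𝔰𝔲(n)` commutes with conjugation**: `P(W̄) = conj P(W)` (its coefficients `½`, `1/(2n)` are real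
and `tr` commutes with conjugation). -/
theorem suProj_mapConj (W : Matrix (Fin n) (Fin n) ℂ) : suProj (𝐂 W) = 𝐂 (suProj W) := by
  have h2 : starRingEnd ℂ (1 / 2 : ℂ) = 1 / 2 := by rw [map_div₀, map_one, map_ofNat]
  have hn : starRingEnd ℂ (1 / (2 * n) * (W - Wᴴ).trace) = 1 / (2 * n) * starRingEnd ℂ (W - Wᴴ).trace := by
    rw [map_mul, map_div₀, map_one, map_mul, map_ofNat, map_natCast]
  rw [suProj_def, suProj_def, map_sub 𝐂, mapConj_smul, mapConj_smul, map_sub 𝐂, map_one 𝐂, h2, hn,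
    conjTranspose_mapConj, ← map_sub 𝐂, trace_mapConj]

/-- The matrix exponential commutes with entrywise conjugation: `e^{Ā} = conj (e^A)`. -/
theorem exp_mapConj (A : Matrix (Fin n) (Fin n) ℂ) : NormedSpace.exp (𝐂 A) = 𝐂 (NormedSpace.exp A) := by
  rw [mapConj_eq_transpose_conjTranspose, Matrix.exp_transpose, Matrix.exp_conjTranspose,
    ← mapConj_eq_transpose_conjTranspose]

/-- **Entrywise conjugation `X ↦ X̄` is an `ℝ`-linear endomorphism of `𝔰𝔲(n)`** (`X̄ᴴ = conj(Xᴴ) = −X̄`, `tr X̄ = conj tr X = 0`). -/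
def suAlgConj : suAlgebra n →ₗ[ℝ] suAlgebra n where
  toFun X := ⟨𝐂 (X : Matrix (Fin n) (Fin n) ℂ), (mem_suAlgebra_iff _).mpr
    ⟨by rw [conjTranspose_mapConj, conjTranspose_coe_suAlgebra, map_neg],
     by rw [trace_mapConj, trace_coe_suAlgebra, RingHom.map_zero]⟩⟩
  map_add' X Y := Subtype.ext (by simp only [Submodule.coe_add, map_add])
  map_smul' r X := Subtype.ext (by simp only [Submodule.coe_smul, mapConj_real_smul, RingHom.id_apply])

/-- `suAlgConj` read as a matrix. -/
@[simp] theorem coe_suAlgConj (X : suAlgebra n) :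
    ((suAlgConj X : suAlgebra n) : Matrix (Fin n) (Fin n) ℂ) = 𝐂 (X : Matrix (Fin n) (Fin n) ℂ) := rfl

/-- **`e^{X̄} = conj (e^X)` in `SU(n)`.** -/
theorem expSU_suAlgConj (X : suAlgebra n) : expSU (suAlgConj X) = suConjAut n (expSU X) := by
  apply Subtype.ext
  rw [coe_expSU, coe_suAlgConj, exp_mapConj]
  rfl

/-- **The momentum conjugation**: every link's momentum conjugated entrywise. -/
def conjReg (P : Edge d L → suAlgebra n) : Edge d L → suAlgebra n := fun e => suAlgConj (P e)

/-- `conjReg` evaluated. -/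
@[simp] theorem conjReg_apply (P : Edge d L → suAlgebra n) (e : Edge d L) : conjReg P e = suAlgConj (P e) := rfl

/-- `conjReg` is linear: scalars. -/
theorem conjReg_smul (c : ℝ) (P : Edge d L → suAlgebra n) : conjReg (c • P) = c • conjReg P := by
  funext e; simp only [conjReg_apply, Pi.smul_apply, map_smul]

/-- `conjReg` is linear: sums. -/
theorem conjReg_add (P Q : Edge d L → suAlgebra n) : conjReg (P + Q) = conjReg P + conjReg Q := by
  funext e; simp only [conjReg_apply, Pi.add_apply, map_add]

/-- The zero register is conjugation invariant. -/
@[simp] theorem conjReg_zero : conjReg (L := L) (d := d) (fun _ => (0 : suAlgebra n)) = fun _ => 0 := by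
  funext e; rw [conjReg_apply, LinearMap.map_zero]

/-- A conjugated group element read as a matrix is the conjugated matrix. -/
theorem coe_suConjAut (g : Matrix.specialUnitaryGroup (Fin n) ℂ) :
    ((suConjAut n g : Matrix.specialUnitaryGroup (Fin n) ℂ) : Matrix (Fin n) (Fin n) ℂ) = 𝐂 (g : Matrix (Fin n) (Fin n) ℂ) :=
  rfl

/-- **The staple loop sum of the conjugated field is the conjugated loop sum**: `Ω_{x,μ}(Ū) = conj Ω_{x,μ}(U)`. -/
theorem plaquetteLoopSum_configConj (V : GaugeConfig d L (Matrix.specialUnitaryGroup (Fin n) ℂ)) (x : Site d L) (μ : Fin d) :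
    plaquetteLoopSum (configConj n V) x μ = 𝐂 (plaquetteLoopSum V x μ) := by
  unfold plaquetteLoopSum
  rw [map_sum]
  refine Finset.sum_congr rfl fun ν _ => ?_
  split_ifs with h
  · rw [RingHom.map_zero]
  · rw [map_add, Exactness.plaquetteHolonomy_configConj, Exactness.plaquetteHolonomy_configConj]
    simp only [configConj, configAut_apply, ← map_inv, ← map_mul, coe_suConjAut]

/-- **Lüscher's generator is conjugation-equivariant**: `Z(Ū) = conj Z(U)`. -/
theorem flowGen_configConj (V : GaugeConfig d L (Matrix.specialUnitaryGroup (Fin n) ℂ)) :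
    flowGen (configConj n V) = conjReg (flowGen V) := by
  funext e
  apply Subtype.ext
  rw [conjReg_apply, coe_suAlgConj, coe_flowGen, coe_flowGen, plaquetteLoopSum_configConj, suProj_mapConj, map_neg]

/-- Register updates (kicks) commute with conjugation. -/
theorem rkRegister_configConj (a b ε : ℝ) (X : Edge d L → suAlgebra n)
    (W : GaugeConfig d L (Matrix.specialUnitaryGroup (Fin n) ℂ)) :
    rkRegister a b ε (conjReg X) (configConj n W) = conjReg (rkRegister a b ε X W) := by
  funext e
  simp only [rkRegister, conjReg_apply, flowGen_configConj W, map_add, map_smul]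

/-- Exponential pushes (drifts) commute with conjugation. -/
theorem rkPush_configConj (X : Edge d L → suAlgebra n) (W : GaugeConfig d L (Matrix.specialUnitaryGroup (Fin n) ℂ)) :
    rkPush (conjReg X) (configConj n W) = configConj n (rkPush X W) := by
  funext e
  simp only [rkPush, conjReg_apply, configConj, configAut_apply, map_mul, expSU_suAlgConj]

/-- **Conjugation covariance of Lüscher's RK3 integrator** (the MEASURED flow): `RK3_ε(Ū) = conj (RK3_ε U)`. -/
theorem wilsonFlowRK3_configConj (ε : ℝ) (V : GaugeConfig d L (Matrix.specialUnitaryGroup (Fin n) ℂ)) :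
    wilsonFlowRK3 ε (configConj n V) = configConj n (wilsonFlowRK3 ε V) := by
  simp only [wilsonFlowRK3]
  conv_lhs => rw [← conjReg_zero (L := L) (d := d) (n := n)]
  simp only [rkRegister_configConj, rkPush_configConj]

/-- The same for any number of RK3 steps. -/
theorem iterate_wilsonFlowRK3_configConj (ε : ℝ) (m : ℕ) (V : GaugeConfig d L (Matrix.specialUnitaryGroup (Fin n) ℂ)) :
    (wilsonFlowRK3 ε)^[m] (configConj n V) = configConj n ((wilsonFlowRK3 ε)^[m] V) :=
  Function.Commute.iterate_left (fun U => wilsonFlowRK3_configConj ε U) m V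

/-- Charge conjugation lifted to phase space: links by `configConj`, momenta by `conjReg`. -/
def conjPhase (z : MDPhase d L n) : MDPhase d L n := (configConj n z.1, conjReg z.2)

/-- Every instruction commutes with the lifted conjugation. -/
theorem MDOp.apply_conjPhase (ε : ℝ) (op : MDOp) (z : MDPhase d L n) :
    op.apply ε (conjPhase z) = conjPhase (op.apply ε z) := by
  cases op with
  | kick c => simp only [MDOp.apply, conjPhase, rkRegister_configConj]
  | drift a' => simp only [MDOp.apply, conjPhase, ← conjReg_smul, rkPush_configConj]

/-- **Every kick–drift word is conjugation-equivariant.** -/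
theorem mdWord_conjPhase (ε : ℝ) (w : List MDOp) (z : MDPhase d L n) :
    mdWord ε w (conjPhase z) = conjPhase (mdWord ε w z) := by
  induction w generalizing z with
  | nil => rfl
  | cons op w ih => rw [mdWord_cons, mdWord_cons, MDOp.apply_conjPhase, ih]

variable [NeZero L]

/-- **`K(P̄) = K(P)`**: `tr(X̄ᴴ X̄) = conj tr(Xᴴ X)` is real. -/
theorem kinetic_conjReg (P : Edge d L → suAlgebra n) : kinetic (conjReg P) = kinetic P := by
  unfold kinetic
  refine Finset.sum_congr rfl fun e _ => ?_
  rw [conjReg_apply, coe_suAlgConj, conjTranspose_mapConj, ← map_mul, trace_mapConj, Complex.conj_re]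

/-- **`H` is invariant under the lifted conjugation** for a conjugation-invariant action. -/
theorem mdHamiltonian_conjPhase {S : GaugeConfig d L (Matrix.specialUnitaryGroup (Fin n) ℂ) → ℝ}
    (hS : ∀ U : GaugeConfig d L (Matrix.specialUnitaryGroup (Fin n) ℂ), S (configConj n U) = S U) (z : MDPhase d L n) :
    mdHamiltonian S (conjPhase z) = mdHamiltonian S z := by
  simp only [mdHamiltonian, conjPhase, hS, kinetic_conjReg]

/-- `ΔH_w` is invariant under the lifted conjugation for a conjugation-invariant action. -/
theorem energyChange_conjPhase {S : GaugeConfig d L (Matrix.specialUnitaryGroup (Fin n) ℂ) → ℝ}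
    (hS : ∀ U : GaugeConfig d L (Matrix.specialUnitaryGroup (Fin n) ℂ), S (configConj n U) = S U) (ε : ℝ) (w : List MDOp)
    (z : MDPhase d L n) :
    mdHamiltonian S (mdWord ε w (conjPhase z)) - mdHamiltonian S (conjPhase z) =
      mdHamiltonian S (mdWord ε w z) - mdHamiltonian S z := by
  rw [mdWord_conjPhase, mdHamiltonian_conjPhase hS, mdHamiltonian_conjPhase hS]

/-- The engine's action `β·S_W` is conjugation invariant (`Exactness.wilsonAction_configAut`: `Re tr` is `C`-even). -/
theorem wilsonMDAction_configConj (β : ℝ) (U : GaugeConfig d L (Matrix.specialUnitaryGroup (Fin n) ℂ)) :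
    β * wilsonAction (fundamentalRep (Fin n)) (configConj n U) = β * wilsonAction (fundamentalRep (Fin n)) U := by
  rw [show configConj n U = configAut (suConjAut n) U from rfl,
    Exactness.wilsonAction_configAut (Exactness.re_trace_fundamentalRep_suConjAut n)]

end Registers

/-! ## §2 The kernel commutes with charge conjugation -/

section Kernel

variable [NeZero L] (B : SuBasis n) (β ε : ℝ) (w : List MDOp)

omit [NeZero L] in
/-- The momentum conjugation as a linear map of momentum fields. -/
def conjRegₗ : (Edge d L → suAlgebra n) →ₗ[ℝ] (Edge d L → suAlgebra n) where
  toFun := conjReg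
  map_add' := conjReg_add
  map_smul' c P := conjReg_smul c P

omit [NeZero L] in
/-- `conjRegₗ` acts as `conjReg`. -/
@[simp] theorem conjRegₗ_apply (P : Edge d L → suAlgebra n) : conjRegₗ (n := n) (L := L) (d := d) P = conjReg P := rfl

/-- **The update intertwines the conjugation**: `hmcStep (Ū) (O c, u) = conj (hmcStep U (c, u))` with `O = coordMap conjRegₗ`
the coordinate form of the momentum conjugation. -/
theorem hmcStep_configConj (U : GaugeConfig d L (Matrix.specialUnitaryGroup (Fin n) ℂ)) (c : Edge d L × B.ι → ℝ) (u : ℝ) :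
    hmcStep B β ε w (configConj n U) (coordMap B conjRegₗ c, u) = configConj n (hmcStep B β ε w U (c, u)) := by
  have hmom : momOf B (coordMap B conjRegₗ c) = conjReg (momOf B c) := (apply_momOf B conjRegₗ c).symm
  have hword : mdWord ε w (configConj n U, conjReg (momOf B c)) = conjPhase (mdWord ε w (U, momOf B c)) :=
    mdWord_conjPhase ε w (U, momOf B c)
  have hΔ : energyChange B β ε w (configConj n U) (coordMap B conjRegₗ c) = energyChange B β ε w U c := by
    unfold energyChange wilsonH
    rw [hmom]
    exact energyChange_conjPhase (wilsonMDAction_configConj β) ε w (U, momOf B c)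
  unfold hmcStep
  simp only [hΔ]
  split_ifs with h
  · rw [hmom, hword]
    rfl
  · rfl

/-- The conjugation of the noise `(c, u) ↦ (O c, u)` preserves its law (`K(P̄) = K(P)`). -/
theorem measurePreserving_noise_conjReg :
    MeasurePreserving (Prod.map (coordMeasurableEquiv B conjRegₗ kinetic_conjReg) id)
      (hmcNoise B (d := d) (L := L)) (hmcNoise B) :=
  (measurePreserving_coordMap B conjRegₗ kinetic_conjReg).prod (MeasurePreserving.id _)

/-- **THE HMC KERNEL COMMUTES WITH CHARGE CONJUGATION**: `κ(Ū) = C_* κ(U)`. -/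
theorem hmcKernel_configConj (U : GaugeConfig d L (Matrix.specialUnitaryGroup (Fin n) ℂ)) :
    hmcKernel B β ε w (configConj n U) = (hmcKernel B β ε w U).map (configConj n) := by
  rw [hmcKernel_apply, hmcKernel_apply]
  have hT := measurePreserving_noise_conjReg B (d := d) (L := L)
  have hmeasT : Measurable (Prod.map (coordMeasurableEquiv B conjRegₗ kinetic_conjReg) id :
      ((Edge d L × B.ι → ℝ) × ℝ) → (Edge d L × B.ι → ℝ) × ℝ) := hT.measurable
  have hfun : hmcStep B β ε w (configConj n U) ∘ Prod.map (coordMeasurableEquiv B conjRegₗ kinetic_conjReg) id =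
      (configConj n) ∘ hmcStep B β ε w U := by
    funext r
    obtain ⟨c, u⟩ := r
    simp only [Function.comp_apply, Prod.map_apply, id_eq, coordMeasurableEquiv_apply]
    exact hmcStep_configConj B β ε w U c u
  calc (hmcNoise B).map (hmcStep B β ε w (configConj n U))
      = ((hmcNoise B).map (Prod.map (coordMeasurableEquiv B conjRegₗ kinetic_conjReg) id)).map
          (hmcStep B β ε w (configConj n U)) := by rw [hT.map_eq]
    _ = (hmcNoise B).map (hmcStep B β ε w (configConj n U) ∘
          Prod.map (coordMeasurableEquiv B conjRegₗ kinetic_conjReg) id) :=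
        Measure.map_map (measurable_hmcStep_right B β ε w _) hmeasT
    _ = (hmcNoise B).map ((configConj n) ∘ hmcStep B β ε w U) := by rw [hfun]
    _ = ((hmcNoise B).map (hmcStep B β ε w U)).map (configConj n) :=
        (Measure.map_map (configConj n).measurable (measurable_hmcStep_right B β ε w U)).symm

omit [NeZero L] in
/-- Charge conjugation is an involution on configurations: `(configConj)⁻¹ = configConj`. -/
theorem configConj_symm_apply (U : GaugeConfig d L (Matrix.specialUnitaryGroup (Fin n) ℂ)) :
    (configConj n).symm U = configConj (d := d) (L := L) n U := rfl

/-- **`conjKernel κ C = κ`** — the form consumed by `SymmetricSamplerOddObservables` / `KernelSymmetryOddObservables`. -/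
theorem conjKernel_hmcKernel_configConj :
    conjKernel (hmcKernel B β ε w) (configConj (d := d) (L := L) n) = hmcKernel B β ε w := by
  refine ProbabilityTheory.Kernel.ext fun U => ?_
  rw [conjKernel_apply, configConj_symm_apply, hmcKernel_configConj,
    Measure.map_map (configConj n).measurable (configConj n).measurable]
  have hid : ((configConj (d := d) (L := L) n) ∘ (configConj n)) = id := by
    funext V
    rw [Function.comp_apply, id_eq, ← configConj_symm_apply (configConj n V)]
    exact (configConj n).symm_apply_apply V
  rw [hid, Measure.map_id]

end Kernel

/-! ## §3 Conjugation-invariant starts stay conjugation invariant: `⟨Im tr h⟩ = 0` along the chain -/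

section Starts

variable [NeZero L] (B : SuBasis n) (β ε : ℝ) (w : List MDOp)

omit [NeZero L] in
/-- The cold start `U ≡ 1` is conjugation fixed (`conj 1 = 1`). -/
theorem configConj_one : configConj n (1 : GaugeConfig d L (Matrix.specialUnitaryGroup (Fin n) ℂ)) = 1 := by
  funext e
  rw [show configConj n (1 : GaugeConfig d L (Matrix.specialUnitaryGroup (Fin n) ℂ)) e =
      suConjAut n ((1 : GaugeConfig d L (Matrix.specialUnitaryGroup (Fin n) ℂ)) e) from rfl]
  exact map_one (suConjAut n)

omit [NeZero L] in
/-- The cold-start law `δ_{U ≡ 1}` is conjugation invariant. -/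
theorem dirac_one_map_configConj :
    (Measure.dirac (1 : GaugeConfig d L (Matrix.specialUnitaryGroup (Fin n) ℂ))).map (configConj n) = Measure.dirac 1 := by
  rw [Measure.map_dirac' (configConj n).measurable, configConj_one]

/-- The hot-start law `∏ₑ dHaar(U_e)` is conjugation invariant (`Exactness.measurePreserving_configAut_piHaar`). -/
theorem piHaar_map_configConj :
    (Measure.pi fun _ : Edge d L => haarProbability (Matrix.specialUnitaryGroup (Fin n) ℂ)).map (configConj n) =
      Measure.pi fun _ : Edge d L => haarProbability (Matrix.specialUnitaryGroup (Fin n) ℂ) :=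
  (Exactness.measurePreserving_configAut_piHaar (d := d) (L := L) (suConjAut n)).map_eq

/-- **From any conjugation-invariant start the `N`-step law of the HMC chain is conjugation invariant**, every `N`. -/
theorem hmcChain_law_map_configConj {μ₀ : Measure (GaugeConfig d L (Matrix.specialUnitaryGroup (Fin n) ℂ))}
    (hμ₀ : μ₀.map (configConj n) = μ₀) (N : ℕ) :
    (μ₀.bind (nHit (hmcKernel B β ε w) N)).map (configConj n) = μ₀.bind (nHit (hmcKernel B β ε w) N) :=
  map_bind_nHit_eq_self (conjKernel_hmcKernel_configConj B β ε w) hμ₀ N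

/-- **`∫ F(Ū) d(μ₀κᴺ) = ∫ F d(μ₀κᴺ)`** for every observable and every `N`, from any conjugation-invariant start. -/
theorem integral_hmcChain_comp_configConj {μ₀ : Measure (GaugeConfig d L (Matrix.specialUnitaryGroup (Fin n) ℂ))}
    (hμ₀ : μ₀.map (configConj n) = μ₀) (N : ℕ) {E : Type*} [NormedAddCommGroup E] [NormedSpace ℝ E]
    (F : GaugeConfig d L (Matrix.specialUnitaryGroup (Fin n) ℂ) → E) :
    ∫ U, F (configConj n U) ∂(μ₀.bind (nHit (hmcKernel B β ε w) N)) = ∫ U, F U ∂(μ₀.bind (nHit (hmcKernel B β ε w) N)) :=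
  (MeasurePreserving.mk (configConj n).measurable (hmcChain_law_map_configConj B β ε w hμ₀ N)).integral_comp' F

/-- **THE RUN CHECK: `E_N[Im tr h] = 0` AT EVERY STEP** for every conjugation-equivariant `SU(N)`-valued functional `h` of the
field (`h(Ū) = conj h(U)`: links, plaquettes, straight / Polyakov lines), from any conjugation-invariant start. -/
theorem integral_hmcChain_im_trace_eq_zero_of_equivariant {μ₀ : Measure (GaugeConfig d L (Matrix.specialUnitaryGroup (Fin n) ℂ))}
    (hμ₀ : μ₀.map (configConj n) = μ₀) (N : ℕ)
    {h : GaugeConfig d L (Matrix.specialUnitaryGroup (Fin n) ℂ) → Matrix.specialUnitaryGroup (Fin n) ℂ}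
    (hh : ∀ U, h (configConj n U) = suConjAut n (h U)) :
    ∫ U, (fundamentalRep (Fin n) (h U)).trace.im ∂(μ₀.bind (nHit (hmcKernel B β ε w) N)) = 0 := by
  have key := integral_hmcChain_comp_configConj B β ε w hμ₀ N
    (fun U : GaugeConfig d L (Matrix.specialUnitaryGroup (Fin n) ℂ) => (fundamentalRep (Fin n) (h U)).trace.im)
  simp only [Exactness.im_trace_odd_of_configConj_equivariant n hh, integral_neg] at key
  linarith

/-- **Polyakov lines (and every straight line): `E_N[Im tr P] = 0` at every step** from any conjugation-invariant start. -/
theorem integral_hmcChain_im_trace_lineHolonomy_eq_zero {μ₀ : Measure (GaugeConfig d L (Matrix.specialUnitaryGroup (Fin n) ℂ))}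
    (hμ₀ : μ₀.map (configConj n) = μ₀) (N : ℕ) (k : Fin d) (m : ℕ) (y : Site d L) :
    ∫ U, (fundamentalRep (Fin n) (lineHolonomy U k m y)).trace.im ∂(μ₀.bind (nHit (hmcKernel B β ε w) N)) = 0 :=
  integral_hmcChain_im_trace_eq_zero_of_equivariant B β ε w hμ₀ N fun U => Exactness.lineHolonomy_configConj n U k m y

/-- **Plaquettes: `E_N[Im tr U_p] = 0` at every step** from any conjugation-invariant start. -/
theorem integral_hmcChain_im_trace_plaquette_eq_zero {μ₀ : Measure (GaugeConfig d L (Matrix.specialUnitaryGroup (Fin n) ℂ))}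
    (hμ₀ : μ₀.map (configConj n) = μ₀) (N : ℕ) (x : Site d L) (i j : Fin d) :
    ∫ U, (fundamentalRep (Fin n) (plaquetteHolonomy U x i j)).trace.im ∂(μ₀.bind (nHit (hmcKernel B β ε w) N)) = 0 :=
  integral_hmcChain_im_trace_eq_zero_of_equivariant B β ε w hμ₀ N fun U => Exactness.plaquetteHolonomy_configConj n U x i j

/-- **Cold start** (`U ≡ 1`): `E_N[Im tr P] = 0` for every straight / Polyakov line at every step `N`. -/
theorem integral_hmcColdStart_im_trace_lineHolonomy_eq_zero (N : ℕ) (k : Fin d) (m : ℕ) (y : Site d L) :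
    ∫ U, (fundamentalRep (Fin n) (lineHolonomy U k m y)).trace.im
        ∂((Measure.dirac 1).bind (nHit (hmcKernel B β ε w) N)) = 0 :=
  integral_hmcChain_im_trace_lineHolonomy_eq_zero B β ε w dirac_one_map_configConj N k m y

/-- **Hot start** (`∏ dHaar`): `E_N[Im tr P] = 0` for every straight / Polyakov line at every step `N`. -/
theorem integral_hmcHotStart_im_trace_lineHolonomy_eq_zero (N : ℕ) (k : Fin d) (m : ℕ) (y : Site d L) :
    ∫ U, (fundamentalRep (Fin n) (lineHolonomy U k m y)).trace.im
        ∂((Measure.pi fun _ : Edge d L => haarProbability (Matrix.specialUnitaryGroup (Fin n) ℂ)).bind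
          (nHit (hmcKernel B β ε w) N)) = 0 :=
  integral_hmcChain_im_trace_lineHolonomy_eq_zero B β ε w piHaar_map_configConj N k m y

end Starts

end Summit.Ventures.LatticeQCDFlow.Scoring
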